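import Mathlib.RingTheory.MvPolynomial.Symmetric.Defs
import Literature.Computability.AlgebraicComplexity.ObstructionTypes
import Literature.Barriers.ValiantsHypothesis.NotViaSaturationsChow
import Literature.Barriers.ValiantsHypothesis.NotViaSaturationsAlonTarsi
import HarnessLib

/-!
# Ikenmeyer–Kandasamy: multiplicity obstructions for the power sum versus the product
# `x₁ ⋯ x_m` that are neither occurrence nor vanishing-ideal occurrence obstructions

Topic `Literature/Computability/AlgebraicComplexity`. Named facts (D-0014) vendoring the main
results of C. Ikenmeyer, U. Kandasamy, *Implementing geometric complexity theory: On the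
separation of orbit closures via symmetries*, STOC 2020 = arXiv:1911.03990 (locators below are
those of the arXiv version), in the tree's vocabulary: `G = GL_m` acting on forms of degree `m`
in the variables `Fin m`; `p = x₁^m + ⋯ + x_m^m` is Mathlib's `MvPolynomial.psum (Fin m) ℂ m`,
`q = x₁ ⋯ x_m` is the tree's `chowMonomial ℂ m = ∏ i, X i` (`NotViaSaturationsChow.lean`);
`mult_{ν^*} ℂ[\overline{G f}]` is `orbitMultiplicity ℂ f m (Weight.dualOfPartition m ν)` and the
plethysm coefficient `a_ν(d, m) = mult_{ν^*} ℂ[Sym^m ℂ^m]_d` is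
`plethysmCoeffOfPartition ℂ m m ν` (IK §3, p. 5: "`ℂ[Sym^D ℂ^m]_d` is a `G`-representation:
`(gf)(q) := f(g⁻¹ q)` … The multiplicity `mult_{ν^*} ℂ[Sym^D ℂ^m]_d` is called the plethysm
coefficient, denoted by `a_ν(d,D)`" — the dual-weight convention of `SchurWeylPlethysm.lean`,
where a weight pins the degree `d`).

WHAT IS REPRODUCED (verbatim):

* Thm. 4.3 (p. 7) [`IK2020_thm_4_3`]: "Let `m = D ≥ 4` be even. Let `d = 2`. Let `λ = (2m)` and
  let `ν = (2m) + (m × 2m)`. Let `p := x₁^m + ⋯ + x_m^m` and `q := x₁ x₂ ⋯ x_m`. … We have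
  • … `mult_{ν^*} ℂ[\overline{Gp}] ≥ 2`. • `1 ≥ mult_{ν^*} ℂ[Gq] ≥ mult_{ν^*} ℂ[\overline{Gq}]`.
  In particular `mult_{ν^*} ℂ[\overline{Gp}] ≥ 2 > 1 ≥ mult_{ν^*} ℂ[\overline{Gq}]` and hence `ν`
  is a multiplicity obstruction that proves the separation `\overline{Gp} ⊄ \overline{Gq}`."
  (`ν = (4m, 2m, …, 2m) ⊢ 2m(m+1)`, `m` parts: `ikPartition m`; the middle term `ℂ[Gq]`, the
  coordinate ring of the orbit, is not rendered.)
* Prop. 5.3 (p. 10) [`IK2020_prop_5_3_1`, `IK2020_prop_5_3_2`]: "Let `ν`, `m`, `D`, `d` be as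
  in Theorem 4.3. • `mult_{ν^*} ℂ[\overline{Gp}] < a_ν(2(m+2), m)` and hence `ν` is not a
  vanishing ideal occurrence obstruction. • If `m` satisfies the Alon–Tarsi condition, then
  `mult_{ν^*} ℂ[\overline{Gq}] > 0` and hence `ν` is not an occurrence obstruction. In particular
  this is true for `m = τ ± 1` for all odd primes `τ`." **Misprint.** `|ν| = 2m(m+1)`, so the
  relevant plethysm coefficient is `a_ν(2(m+1), m)`, as in the proof (p. 10: "It remains to
  prove that `a_ν(2(m+1), m) ≥ 3`, which is postponed to Proposition 12.1"); the formal
  statement is immune to the misprint because `plethysmCoeffOfPartition` carries no outer degree.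
  The Alon–Tarsi condition is the tree's `Literature.Barriers.ValiantsHypothesis.AlonTarsiConjecture m`
  (`NotViaSaturations.lean`; IK §5, p. 10: "If the number of even `m × m` Latin squares differs
  from the number of odd `m × m` Latin squares, then we say that `m` satisfies the Alon–Tarsi
  condition").

WHAT IS PROVED HERE (kernel): `ν` is a multiplicity obstruction against `p ∈ Δ_m[q]`
(`ik2020_isMultiplicityObstructionAt`), hence `p ∉ Δ_m[q]` by the multiplicity-obstruction
principle (`ik2020_psum_not_mem_orbitClosure`); for `m` satisfying Alon–Tarsi, `ν` is a
PURE multiplicity obstruction in the sense of `ObstructionTypes.lean`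
(`ik2020_isPureMultiplicityObstructionAt`) — IK §2 (p. 3): "Theorem 4.3 gives the first family of
multiplicity obstructions that are neither occurrence obstructions nor vanishing ideal
occurrence obstructions"; and, from the "In particular … `m = τ ± 1` for all odd primes `τ`"
clause of Prop. 5.3 (`IK2020_prop_5_3_2_primes`), the same conclusion with no Alon–Tarsi
hypothesis for such `m` (`ik2020_isPureMultiplicityObstructionAt_of_prime`), e.g. `m = 4`
(`ik2020_isPureMultiplicityObstructionAt_four`: `ν = (16, 8, 8, 8)`). This is the only kind of obstruction not excluded for determinant
versus permanent by BIP's Theorem 1.4 together with (conjecturally) vanishing-ideal methods, cf.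
`bip2019_remaining_obstruction_types`.

NOT here: IK's Thm. 4.2 (the general lower bound via multi-Littlewood–Richardson coefficients),
Prop. 4.1, the tableau-lifting theorem, Prop. 12.1 (`a_ν(2(m+1), m) ≥ 3`); the Alon–Tarsi
theorems of Drisko (`m = τ + 1`) and Glynn (`m = τ - 1`) themselves (only IK's printed
consequence for `mult_{ν^*}` is vendored, as `IK2020_prop_5_3_2_primes`).

## References

* C. Ikenmeyer, U. Kandasamy, *Implementing geometric complexity theory: On the separation of
  orbit closures via symmetries*, Proc. 52nd ACM STOC (2020) 713–726; arXiv:1911.03990, §2, §3,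
  Thm. 4.3, Prop. 5.3. [IkenmeyerKandasamy2019]
* J. Dörfler, C. Ikenmeyer, G. Panova, SIAM J. Appl. Algebra Geom. 4 (2020) (vanishing ideal
  occurrence obstructions). [DorflerIkenmeyerPanova2020]
* P. Bürgisser, J. Hüttenhain, C. Ikenmeyer, Proc. AMS 145 (2017) (Alon–Tarsi, `w_n = X₁⋯X_n`).
  [BurgisserHuttenhainIkenmeyer2017]

Provenance: pub-gct census cell, LEAN-IN-TREE import of the typed census (toy-model rung "pure
multiplicity obstructions exist"); page numbers are PDF pages of arXiv:1911.03990.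
-/

noncomputable section

open MvPolynomial

namespace Literature.Computability.AlgebraicComplexity

open _root_.Literature.NumberTheory.DiophantineGeometry
open _root_.Literature.Barriers.ValiantsHypothesis (chowMonomial chowMonomial_isHomogeneous
  AlonTarsiConjecture)

/-- The power sum `x₁^n + ⋯ + x_N^n` (Mathlib's `psum`) is a form of degree `n`. [folklore] -/
theorem psum_isHomogeneous (σ : Type*) [Fintype σ] (R : Type*) [CommSemiring R] (n : ℕ) :
    (psum σ R n).IsHomogeneous n := by
  rw [psum]
  exact IsHomogeneous.sum _ _ _ fun i _ => isHomogeneous_X_pow i n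

/-- Ikenmeyer–Kandasamy's partition `ν = (2m) + (m × 2m) = (4m, 2m, …, 2m)` (`m` parts) of
`2m(m+1)` (Thm. 4.3: "let `ν = (2m) + (m × 2m)`"; row-wise sum, `a × b = (b, …, b)` with `a` rows,
§3 p. 5). Built with `Nat.Partition.ofSums` (for `m = 0` the empty partition).
[cite: IkenmeyerKandasamy2019, Thm. 4.3] -/
def ikPartition (m : ℕ) : Nat.Partition (2 * m * (m + 1)) :=
  Nat.Partition.ofSums _ ({4 * m} + Multiset.replicate (m - 1) (2 * m)) (by
    cases m with
    | zero => simp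
    | succ j => simp [Multiset.sum_replicate]; ring)

/-- NAMED FACT (**Ikenmeyer–Kandasamy 2020, Thm. 4.3**, arXiv:1911.03990 p. 7). For even
`m ≥ 4`, with `p = x₁^m + ⋯ + x_m^m`, `q = x₁ ⋯ x_m`, `G = GL_m` and `ν = (2m) + (m × 2m)`:
"`mult_{ν^*} ℂ[\overline{Gp}] ≥ 2`" and "`1 ≥ mult_{ν^*} ℂ[Gq] ≥ mult_{ν^*} ℂ[\overline{Gq}]`",
"hence `ν` is a multiplicity obstruction that proves the separation `\overline{Gp} ⊄ \overline{Gq}`."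
Rendered on the orbit CLOSURES (`orbitMultiplicity`, dual-weight convention).
[cite: IkenmeyerKandasamy2019, Thm. 4.3] -/
def IK2020_thm_4_3 : Prop :=
  ∀ (m : ℕ), 4 ≤ m → Even m →
    2 ≤ orbitMultiplicity ℂ (psum (Fin m) ℂ m) m (Weight.dualOfPartition m (ikPartition m)) ∧
      orbitMultiplicity ℂ (chowMonomial ℂ m) m (Weight.dualOfPartition m (ikPartition m)) ≤ 1

/-- NAMED FACT (**Ikenmeyer–Kandasamy 2020, Prop. 5.3, first bullet**, p. 10): with `ν, m` as in
Thm. 4.3, "`mult_{ν^*} ℂ[\overline{Gp}] < a_ν(2(m+2), m)` [read `a_ν(2(m+1), m)`, the plethysm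
coefficient of `ν ⊢ 2m(m+1)` in `Sym^{2(m+1)} Sym^m ℂ^m`; see the file header on the misprint]
and hence `ν` is not a vanishing ideal occurrence obstruction." (`ν^*` occurs in the vanishing
ideal of `\overline{Gp}` as well.) [cite: IkenmeyerKandasamy2019, Prop. 5.3] -/
def IK2020_prop_5_3_1 : Prop :=
  ∀ (m : ℕ), 4 ≤ m → Even m →
    orbitMultiplicity ℂ (psum (Fin m) ℂ m) m (Weight.dualOfPartition m (ikPartition m)) <
      plethysmCoeffOfPartition ℂ m m (ikPartition m)

/-- NAMED FACT (**Ikenmeyer–Kandasamy 2020, Prop. 5.3, second bullet**, p. 10): with `ν, m` as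
in Thm. 4.3, "If `m` satisfies the Alon-Tarsi condition, then `mult_{ν^*} ℂ[\overline{Gq}] > 0`
and hence `ν` is not an occurrence obstruction. In particular this is true for `m = τ ± 1` for
all odd primes `τ`." (Proof in print: Kumar's occurrences of `(m)^*` and `(m × m)^*` in
`ℂ[\overline{G(x₁⋯x_m)}]` under Alon–Tarsi, and the semigroup property.) The Alon–Tarsi
condition for `m` ("the number of even `m × m` Latin squares differs from the number of odd
`m × m` Latin squares", IK §5 p. 10) is the hypothesis, taken from `NotViaSaturations.lean`;
the fact itself is an unconditional published theorem. [cite: IkenmeyerKandasamy2019, Prop. 5.3] -/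
def IK2020_prop_5_3_2 : Prop :=
  ∀ (m : ℕ), 4 ≤ m → Even m → AlonTarsiConjecture m →
    0 < orbitMultiplicity ℂ (chowMonomial ℂ m) m (Weight.dualOfPartition m (ikPartition m))

/-- NAMED FACT (**Ikenmeyer–Kandasamy 2020, Prop. 5.3, second bullet, "in particular" clause**,
p. 10): with `ν, m` as in Thm. 4.3, "`mult_{ν^*} ℂ[\overline{Gq}] > 0` … In particular this is
true for `m = τ ± 1` for all odd primes `τ`." (In print this is the previous bullet combined with
the theorems of Drisko [`m = τ + 1`, Adv. Math. 128 (1997)] and Glynn [`m = τ - 1`, SIAM J.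
Discrete Math. 24 (2010)] that such `m` satisfy the Alon–Tarsi condition; only IK's stated
consequence is vendored here.) The standing hypotheses `m ≥ 4` even of Thm. 4.3 are kept
(`m = τ ± 1` is even). [cite: IkenmeyerKandasamy2019, Prop. 5.3] -/
def IK2020_prop_5_3_2_primes : Prop :=
  ∀ (m τ : ℕ), 4 ≤ m → τ.Prime → Odd τ → (m = τ + 1 ∨ m = τ - 1) →
    0 < orbitMultiplicity ℂ (chowMonomial ℂ m) m (Weight.dualOfPartition m (ikPartition m))

/-- KERNEL: under Thm. 4.3, `ν` is a multiplicity obstruction against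
`x₁^m + ⋯ + x_m^m ∈ Δ_m[x₁ ⋯ x_m]` (`mult_{ν^*}(q) ≤ 1 < 2 ≤ mult_{ν^*}(p)`), in the sense of
`IsMultiplicityObstructionAt`. IK Thm. 4.3 ("`ν` is a multiplicity obstruction").
[cite: IkenmeyerKandasamy2019, Thm. 4.3] -/
theorem ik2020_isMultiplicityObstructionAt (h : IK2020_thm_4_3) {m : ℕ} (h4 : 4 ≤ m)
    (he : Even m) :
    IsMultiplicityObstructionAt (chowMonomial ℂ m) (psum (Fin m) ℂ m) m
      (Weight.dualOfPartition m (ikPartition m)) := by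
  obtain ⟨hp, hq⟩ := h m h4 he
  unfold IsMultiplicityObstructionAt
  omega

/-- KERNEL: the separation `\overline{Gp} ⊄ \overline{Gq}` of Thm. 4.3, i.e.
`x₁^m + ⋯ + x_m^m ∉ Δ_m[x₁ ⋯ x_m]` for even `m ≥ 4`, from the fact `IK2020_thm_4_3` and the
multiplicity-obstruction principle `orbitMultiplicity_le_of_mem_orbitClosure` (discharged in
`MultiplicityObstructionsProofs.lean`). IK Thm. 4.3 ("proves the separation").
[cite: IkenmeyerKandasamy2019, Thm. 4.3] -/
theorem ik2020_psum_not_mem_orbitClosure (h : IK2020_thm_4_3)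
    (hprin : orbitMultiplicity_le_of_mem_orbitClosure) {m : ℕ} (h4 : 4 ≤ m) (he : Even m) :
    psum (Fin m) ℂ m ∉ orbitClosure (chowMonomial ℂ m) :=
  not_mem_orbitClosure_of_isMultiplicityObstructionAt hprin (by omega)
    (chowMonomial_isHomogeneous ℂ m) (psum_isHomogeneous (Fin m) ℂ m)
    (ik2020_isMultiplicityObstructionAt h h4 he)

/-- KERNEL: for even `m ≥ 4` satisfying the Alon–Tarsi condition, `ν` is a PURE multiplicity
obstruction (`0 < mult_{ν^*}(q) < mult_{ν^*}(p) < a_ν`): neither an occurrence obstruction nor a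
vanishing ideal occurrence obstruction. IK §2 (p. 3) and Prop. 5.3; from the three facts above.
[cite: IkenmeyerKandasamy2019, Prop. 5.3] -/
theorem ik2020_isPureMultiplicityObstructionAt (h43 : IK2020_thm_4_3)
    (h1 : IK2020_prop_5_3_1) (h2 : IK2020_prop_5_3_2) {m : ℕ} (h4 : 4 ≤ m) (he : Even m)
    (hAT : AlonTarsiConjecture m) :
    IsPureMultiplicityObstructionAt (chowMonomial ℂ m) (psum (Fin m) ℂ m) m
      (Weight.dualOfPartition m (ikPartition m)) := by
  obtain ⟨hp, hq⟩ := h43 m h4 he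
  have hlt := h1 m h4 he
  have hpos := h2 m h4 he hAT
  unfold plethysmCoeffOfPartition at hlt
  unfold IsPureMultiplicityObstructionAt
  exact ⟨hpos, by omega, hlt⟩

/-- KERNEL: for `m = τ ± 1 ≥ 4`, `τ` an odd prime, `ν` is a PURE multiplicity obstruction against
`x₁^m + ⋯ + x_m^m ∈ Δ_m[x₁ ⋯ x_m]` — unconditionally in `m` (no Alon–Tarsi hypothesis), from
Thm. 4.3, Prop. 5.3 (1) and the "in particular" clause of Prop. 5.3 (2). IK §2 (p. 3): "the first
family of multiplicity obstructions that are neither occurrence obstructions nor vanishing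
ideal occurrence obstructions". [cite: IkenmeyerKandasamy2019, Prop. 5.3] -/
theorem ik2020_isPureMultiplicityObstructionAt_of_prime (h43 : IK2020_thm_4_3)
    (h1 : IK2020_prop_5_3_1) (h2 : IK2020_prop_5_3_2_primes) {m τ : ℕ} (h4 : 4 ≤ m)
    (hτ : τ.Prime) (hodd : Odd τ) (hm : m = τ + 1 ∨ m = τ - 1) :
    IsPureMultiplicityObstructionAt (chowMonomial ℂ m) (psum (Fin m) ℂ m) m
      (Weight.dualOfPartition m (ikPartition m)) := by
  have he : Even m := by
    rcases hm with rfl | rfl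
    · exact hodd.add_odd odd_one
    · exact Nat.Odd.sub_odd hodd odd_one
  obtain ⟨hp, hq⟩ := h43 m h4 he
  have hlt := h1 m h4 he
  have hpos := h2 m τ h4 hτ hodd hm
  unfold plethysmCoeffOfPartition at hlt
  unfold IsPureMultiplicityObstructionAt
  exact ⟨hpos, by omega, hlt⟩

/-- KERNEL, the smallest instance (`m = 4 = 3 + 1`): given IK's three facts,
`ν = (16, 8, 8, 8)` is a pure multiplicity obstruction against
`x₁⁴ + x₂⁴ + x₃⁴ + x₄⁴ ∈ Δ₄[x₁ x₂ x₃ x₄]` (`2 ≤ mult_{ν^*}(p) < a_ν(10, 4)` and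
`0 < mult_{ν^*}(q) ≤ 1`). [cite: IkenmeyerKandasamy2019, Thm. 4.3] -/
theorem ik2020_isPureMultiplicityObstructionAt_four (h43 : IK2020_thm_4_3)
    (h1 : IK2020_prop_5_3_1) (h2 : IK2020_prop_5_3_2_primes) :
    IsPureMultiplicityObstructionAt (chowMonomial ℂ 4) (psum (Fin 4) ℂ 4) 4
      (Weight.dualOfPartition 4 (ikPartition 4)) :=
  ik2020_isPureMultiplicityObstructionAt_of_prime h43 h1 h2 (τ := 3) le_rfl Nat.prime_three
    (by decide) (Or.inl rfl)

/-- KERNEL: for EVERY even `4 ≤ m ≤ 24`, `ν` is a PURE multiplicity obstruction against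
`x₁^m + ⋯ + x_m^m ∈ Δ_m[x₁ ⋯ x_m]` — unconditionally in `m`: the Alon–Tarsi hypothesis of
`ik2020_isPureMultiplicityObstructionAt` is discharged by the published theorems of Drisko
(`m = τ + 1`) and Glynn (`m = τ - 1`), which cover all even sizes below `26`
(`alonTarsi_of_even_le_24`; Glynn, Cor. 3.4: "The smallest unsolved case of even order for the
Alon-Tarsi conjecture … is 26"). [cite: IkenmeyerKandasamy2019, Prop. 5.3]
[cite: Drisko1997, Thm. 9] [cite: Glynn2010AlonTarsi, Thm. 3.2 and Cor. 3.4] -/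
theorem ik2020_isPureMultiplicityObstructionAt_of_even_le_24 (h43 : IK2020_thm_4_3)
    (h1 : IK2020_prop_5_3_1) (h2 : IK2020_prop_5_3_2)
    (hD : Literature.Barriers.ValiantsHypothesis.Drisko1997_AlonTarsi)
    (hG : Literature.Barriers.ValiantsHypothesis.Glynn2010_AlonTarsi)
    {m : ℕ} (h4 : 4 ≤ m) (he : Even m) (h24 : m ≤ 24) :
    IsPureMultiplicityObstructionAt (chowMonomial ℂ m) (psum (Fin m) ℂ m) m
      (Weight.dualOfPartition m (ikPartition m)) :=
  ik2020_isPureMultiplicityObstructionAt h43 h1 h2 h4 he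
    (Literature.Barriers.ValiantsHypothesis.alonTarsi_of_even_le_24 hD hG he (by omega) h24)

/-- KERNEL, the instance `m = 6 = 5 + 1 = 7 - 1` spelled out from the general Prop. 5.3 (2)
(not the "in particular" clause): `ν = (36, 12, …, 12)` (`ikPartition 6`) is a pure multiplicity
obstruction against `x₁⁶ + ⋯ + x₆⁶ ∈ Δ₆[x₁ ⋯ x₆]`. [cite: IkenmeyerKandasamy2019, Prop. 5.3]
[cite: Drisko1997, Thm. 9] -/
theorem ik2020_isPureMultiplicityObstructionAt_six (h43 : IK2020_thm_4_3)
    (h1 : IK2020_prop_5_3_1) (h2 : IK2020_prop_5_3_2)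
    (hD : Literature.Barriers.ValiantsHypothesis.Drisko1997_AlonTarsi)
    (hG : Literature.Barriers.ValiantsHypothesis.Glynn2010_AlonTarsi) :
    IsPureMultiplicityObstructionAt (chowMonomial ℂ 6) (psum (Fin 6) ℂ 6) 6
      (Weight.dualOfPartition 6 (ikPartition 6)) :=
  ik2020_isPureMultiplicityObstructionAt_of_even_le_24 h43 h1 h2 hD hG (by norm_num)
    (by decide) (by norm_num)

end Literature.Computability.AlgebraicComplexity
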